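import Summits.AtomisticToContinuum.Crystallization.Theorems.FrustratedLawDichotomyStrainedPatchHomEntrySemanticQuotLeaf
import Summits.AtomisticToContinuum.Crystallization.Theorems.FrustratedLawDichotomyStrainedPatchHomEntryTreeShard

/-!
# (R5) THE BULK VERDICT OF THE QUOTIENT ROOT: `bulkLeafQ μ = sectorOut ∨ ballOut ∨ (¬shufOut ∧ entryLeafOKHQ μ)` — definition, `semOKHQ` soundness, tree / search / shard currencies
# (27623 `(H) HomFloor`, hcp half; hand-1 g42; lens-5 NODE 88 «HomEntrySemanticQuot» §5 R5 «driver: generate … on the QUARTER root box only; emit sectorOut/ballOut leaves first»; critic row 1510 (1))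

decomp-a2c hand-1 g42 (crux `AperiodicFrustratedLawGap`, stmt-AtomisticToContinuum-27623).  The `(H)` root of record is certified shard by shard by the
plan driver (`gen_cert2h.py`, hand-2 g26 / hand-1 g24): per dyadic sub-box of the root a certificate tree found NATIVELY by
`…EntryTreeShard.searchTreeF (verdict)`, then checked literally by `decide +kernel` (`…CertHcpHPilotSh5Shard001.lit_sh500` …), glued upward by
`exists_tree_split_lit`.  Its verdict is the SIGNED v8 `…EntryTableHcpV.entryLeafOKHVK μ` whose first disjunct is the shuffle-sign prune `shufOut`.

The quotient root (NODE 88: quarter `U`-root `rootCHQ/rootWHQ` × the `120°` sector `Σ`, currency `semOKHQ`, no `ξ₀/ξ₂` signs) needs the SIGN-FREE bulk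
verdict in the same pipeline.  This file types it — nothing new is evaluated, every disjunct is a tree Boolean:

* §1 `quickQ μ c w := innerGuardQ c w ∧ entryLeafOKHQ μ c w` (the quick verdict of record with its own `shufOut` disjunct switched off by the guard —
  sound sign-free by `…QuotLeaf.entryLeafOKHQ_sound_noShuf`) and ★ `bulkLeafQ μ := quotLeaf (quickQ μ)` = `sectorOut ∨ ballOut ∨ quickQ μ` — the two
  VACUOUS prunes of the fundamental domain FIRST (R5), then the cheap-first tables / fits / radial / column prunes.  Computable; cheap-first.
* §2 ★ `semOKHQ_of_quickQ`, ★★ `semOKHQ_of_bulkLeafQ` (a box accepted by the bulk verdict is a `semOKHQ μ` fact), and the three SHARD CURRENCIES of the plan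
  driver re-targeted: ★★ `semOKHQ_of_treeOK_bulkLeafQ` (literal kernel tree), `semOKHQ_of_exists_tree_bulkLeafQ` (∃-tree, the glue currency of
  `exists_tree_split_lit`), `semOKHQ_of_searchOK_bulkLeafQ` (kernel search) — each shard of the quotient root so certified is a «listed quotient fact» for
  `…QuotColumn.semOKHQ_root_of_colManifest5Q` / `homFloor_of_entryTree6RBKP4_colManifest5Q`, at every level `μ' ≤ μ` (`semOKHQ_mono_level`).
* §3 `bulkLeafQ_of_quickQ`, `bulkLeafQ_of_sectorOut`, `bulkLeafQ_of_ballOut` (driver bookkeeping: which disjunct closed a leaf) and kernel smoke on three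
  literal quarter-root grid boxes: a `ξ₁ > 0` box (sector prune), a cube-corner box inside `Σ` (ball prune), and a bulk box far off the hcp well in `u₀₁` where the
  quick table fires with the guard open — the three leaf kinds the R5 driver emits, each in one `decide +kernel`.

Definitions + formal bookkeeping + kernel smoke; 0 sorry; standard axioms; no instances / notation / `#eval`.  `--supports stmt-AtomisticToContinuum-27623`.
-/

namespace Summit.AtomisticToContinuum.Crystallization.Theorems.FrustratedLawDichotomyStrainedPatchHomEntryLeafHT

open scoped BigOperators RealInnerProductSpace
open Literature.Analysis.ValidatedNumerics.Numerics
open Summit.AtomisticToContinuum.Crystallization.Theorems.ChargedEnergyGapNegative (E3)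
open Summit.AtomisticToContinuum.Crystallization.Theorems.FrustratedLawDichotomySchurCut (effPot w₄₅ ω₄)
open Summit.AtomisticToContinuum.Crystallization.Theorems.FrustratedLawDichotomyAveragingRuleTightFree (TightNearCap BadNearCap)
open Summit.AtomisticToContinuum.Crystallization.Theorems.FrustratedLawDichotomyExemptAbsorption (ExemptNear)
open Summit.AtomisticToContinuum.Crystallization.Theorems.FrustratedLawDichotomyStrainedPatchHomSplit (ExRec latPt hexFrame hcpShift HomFloor)
open Summit.AtomisticToContinuum.Crystallization.Theorems.FrustratedLawDichotomyStrainedPatchHomCertTree (CertTree treeOK)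
open Summit.AtomisticToContinuum.Crystallization.Theorems.FrustratedLawDichotomyStrainedPatchHomEntryTable (muRec)
open Summit.AtomisticToContinuum.Crystallization.Theorems.FrustratedLawDichotomyStrainedPatchHomEntrySearch (searchOK exists_tree_of_searchOK)
open Summit.AtomisticToContinuum.Crystallization.Theorems.FrustratedLawDichotomyStrainedPatchHomEntryQuickHcp (entryLeafOKHQ)
open Summit.AtomisticToContinuum.Crystallization.Theorems.FrustratedLawDichotomyStrainedPatchHomEntryFlipHcp (shufOut)
open Summit.AtomisticToContinuum.Crystallization.Theorems.FrustratedLawDichotomyStrainedPatchHomEntryFitHcpCentred (innerGuardQ)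
open Summit.AtomisticToContinuum.Crystallization.Theorems.FrustratedLawDichotomyStrainedPatchHomLeafTableCheckHcpV (entryLeafOKHQ_sound_noShuf)
open Summit.AtomisticToContinuum.Crystallization.Theorems.FrustratedLawDichotomyStrainedPatchHomEntrySemanticQuot
  (semOKHQ semOKHQ_of_sound semOKHQ_mono_level semOKHQ_of_treeOK quotLeaf semOKHQ_of_quotLeaf sectorOut ballOut rootCHQ rootWHQ)

/-! ## §1. The sign-free quick verdict and the bulk verdict -/

/-- ★ The QUICK VERDICT OF RECORD with its shuffle-sign disjunct switched off: `¬shufOut ∧ entryLeafOKHQ μ` (guard first, so a box the old currency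
would have sign-pruned is refused at the cost of one sign test). Computable. -/
def quickQ (μ : ℤ) (c w : (Fin 3 × Fin 3) ⊕ Fin 3 → ℤ) : Bool := innerGuardQ c w && entryLeafOKHQ μ c w

/-- ★★ **THE BULK VERDICT OF THE QUOTIENT ROOT**: the two vacuous prunes of the fundamental domain first (`sectorOut`: the box misses the sector `Σ`;
`ballOut`: the box misses the ball `‖ξ‖ ≤ 1/4`), then the sign-free quick verdict. Computable; the leaf verdict of the R5 shard driver. -/
def bulkLeafQ (μ : ℤ) : ((Fin 3 × Fin 3) ⊕ Fin 3 → ℤ) → ((Fin 3 × Fin 3) ⊕ Fin 3 → ℤ) → Bool := quotLeaf (quickQ μ)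

/-- Unfolding the bulk verdict. [formal bookkeeping] -/
theorem bulkLeafQ_eq (μ : ℤ) (c w : (Fin 3 × Fin 3) ⊕ Fin 3 → ℤ) : bulkLeafQ μ c w = (sectorOut c w || ballOut c w || quickQ μ c w) := rfl

/-! ## §2. Soundness in the quotient currency and the shard currencies -/

/-- ★ Soundness of `quickQ` in the `hver` shape WITHOUT shuffle signs. [formal bookkeeping: `entryLeafOKHQ_sound_noShuf` with the guard] -/
theorem quickQ_sound {μ : ℤ} {c w : (Fin 3 × Fin 3) ⊕ Fin 3 → ℤ} (h : quickQ μ c w = true)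
    (U : E3 →L[ℝ] E3) (ξ : E3) (hsa : ∀ v v' : E3, ⟪U v, v'⟫ = ⟪v, U v'⟫) (hU : ‖U - 1‖ ≤ 1 / 4)
    (hbox : ∀ ab : Fin 3 × Fin 3, |(U (EuclideanSpace.single ab.2 (1 : ℝ))) ab.1 - (c (Sum.inl ab) : ℝ) / SC| ≤ (w (Sum.inl ab) : ℝ) / SC)
    (hξ : ∀ i : Fin 3, |ξ i - (c (Sum.inr i) : ℝ) / SC| ≤ (w (Sum.inr i) : ℝ) / SC) :
    (∀ (M : ℕ) (z : Fin M → E3) (cc : Fin M), Function.Injective z →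
        Set.range z = {x : E3 | dist x (z cc) ≤ 133 / 10 ∧ ∃ a : Fin 3 → ℤ,
          x = z cc + latPt U hexFrame a ∨ x = z cc + latPt U hexFrame a + U (hcpShift + ξ)} →
        TightNearCap (9 / 5) (3 / 2) z cc ∨ ExemptNear (9 / 5) ExRec z cc ∨ BadNearCap (9 / 5) (3 / 2) z cc) ∨
      (μ : ℝ) / SC ≤ ∑ b ∈ (Fintype.piFinset fun _ : Fin 3 => Finset.Icc (-7 : ℤ) 7).filter (fun b => b ≠ 0), effPot w₄₅ ω₄ (3 / 400) ‖latPt U hexFrame b‖ +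
        ∑ b ∈ (Fintype.piFinset fun _ : Fin 3 => Finset.Icc (-7 : ℤ) 7), effPot w₄₅ ω₄ (3 / 400) ‖latPt U hexFrame b + U (hcpShift + ξ)‖ := by
  simp only [quickQ, innerGuardQ, Bool.and_eq_true, Bool.not_eq_true'] at h
  exact entryLeafOKHQ_sound_noShuf h.2 h.1 U ξ hsa hU hbox hξ

/-- ★ A box accepted by the sign-free quick verdict is a `semOKHQ μ` fact. [formal bookkeeping: `semOKHQ_of_sound`] -/
theorem semOKHQ_of_quickQ {μ : ℤ} {c w : (Fin 3 × Fin 3) ⊕ Fin 3 → ℤ} (h : quickQ μ c w = true) : semOKHQ μ c w = true :=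
  semOKHQ_of_sound (quickQ μ) (fun _ _ hv U ξ hsa _ hU _ hbox hξ _ _ => quickQ_sound hv U ξ hsa hU hbox hξ) h

/-- ★★ **A BOX ACCEPTED BY THE BULK VERDICT IS A `semOKHQ μ` FACT.** [formal bookkeeping: `semOKHQ_of_quotLeaf`] -/
theorem semOKHQ_of_bulkLeafQ {μ : ℤ} {c w : (Fin 3 × Fin 3) ⊕ Fin 3 → ℤ} (h : bulkLeafQ μ c w = true) : semOKHQ μ c w = true :=
  semOKHQ_of_quotLeaf (fun _ _ h' => semOKHQ_of_quickQ h') h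

/-- ★★ SHARD CURRENCY 1 (literal kernel tree): a certificate tree over the bulk verdict accepted on a box makes it a `semOKHQ μ` fact.
[formal bookkeeping: `semOKHQ_of_treeOK`] -/
theorem semOKHQ_of_treeOK_bulkLeafQ {μ : ℤ} (t : CertTree ((Fin 3 × Fin 3) ⊕ Fin 3)) {c w : (Fin 3 × Fin 3) ⊕ Fin 3 → ℤ}
    (h : treeOK (bulkLeafQ μ) t c w = true) : semOKHQ μ c w = true :=
  semOKHQ_of_treeOK (bulkLeafQ μ) (fun _ _ h' => semOKHQ_of_bulkLeafQ h') t c w h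

/-- SHARD CURRENCY 2 (∃-tree, the glue currency of `exists_tree_split_lit`). [formal bookkeeping] -/
theorem semOKHQ_of_exists_tree_bulkLeafQ {μ : ℤ} {c w : (Fin 3 × Fin 3) ⊕ Fin 3 → ℤ}
    (h : ∃ t : CertTree ((Fin 3 × Fin 3) ⊕ Fin 3), treeOK (bulkLeafQ μ) t c w = true) : semOKHQ μ c w = true := by
  obtain ⟨t, ht⟩ := h
  exact semOKHQ_of_treeOK_bulkLeafQ t ht

/-- SHARD CURRENCY 3 (kernel search). [formal bookkeeping: `exists_tree_of_searchOK`] -/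
theorem semOKHQ_of_searchOK_bulkLeafQ {μ : ℤ} {sel : ℕ → ((Fin 3 × Fin 3) ⊕ Fin 3 → ℤ) → ((Fin 3 × Fin 3) ⊕ Fin 3 → ℤ) → (Fin 3 × Fin 3) ⊕ Fin 3}
    {fuel d : ℕ} {c w : (Fin 3 × Fin 3) ⊕ Fin 3 → ℤ} (h : searchOK (bulkLeafQ μ) sel fuel d c w = true) : semOKHQ μ c w = true :=
  semOKHQ_of_exists_tree_bulkLeafQ (exists_tree_of_searchOK (bulkLeafQ μ) sel fuel d c w h)

/-- ★ A shard certified at level `μ₀` (e.g. `muRec`, the level the tables are cut at) serves every level of record `μ ≤ μ₀`. [formal bookkeeping] -/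
theorem semOKHQ_of_treeOK_bulkLeafQ_level {μ μ₀ : ℤ} (hle : μ ≤ μ₀) (t : CertTree ((Fin 3 × Fin 3) ⊕ Fin 3)) {c w : (Fin 3 × Fin 3) ⊕ Fin 3 → ℤ}
    (h : treeOK (bulkLeafQ μ₀) t c w = true) : semOKHQ μ c w = true :=
  semOKHQ_mono_level hle (semOKHQ_of_treeOK_bulkLeafQ t h)

/-! ## §3. Driver bookkeeping and kernel smoke on literal quarter-root grid boxes -/

/-- The quick verdict closes a bulk leaf. [formal bookkeeping] -/
theorem bulkLeafQ_of_quickQ {μ : ℤ} {c w : (Fin 3 × Fin 3) ⊕ Fin 3 → ℤ} (h : quickQ μ c w = true) : bulkLeafQ μ c w = true := by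
  rw [bulkLeafQ_eq, h, Bool.or_true]

/-- The sector prune closes a bulk leaf (at every level). [formal bookkeeping] -/
theorem bulkLeafQ_of_sectorOut (μ : ℤ) {c w : (Fin 3 × Fin 3) ⊕ Fin 3 → ℤ} (h : sectorOut c w = true) : bulkLeafQ μ c w = true := by
  rw [bulkLeafQ_eq, h, Bool.true_or, Bool.true_or]

/-- The ball prune closes a bulk leaf (at every level). [formal bookkeeping] -/
theorem bulkLeafQ_of_ballOut (μ : ℤ) {c w : (Fin 3 × Fin 3) ⊕ Fin 3 → ℤ} (h : ballOut c w = true) : bulkLeafQ μ c w = true := by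
  rw [bulkLeafQ_eq, h, Bool.or_true, Bool.true_or]

set_option maxRecDepth 100000 in
/-- Quarter-root grid box: `U`-part the depth-1 half `u₀₁ ∈ [1/8, 1/4]` of the quarter root (other entries the whole root ranges), shuffle part the
depth-3 cell `ξ ∈ [0, 1/16] × [1/16, 1/8] × [0, 1/16]` — it lies in `ξ₁ > 0`, outside `Σ`: ONE sector-prune leaf. [kernel] -/
theorem bulkLeafQ_smoke_sector :
    bulkLeafQ muRec
      (Function.update (Function.update (Function.update (Function.update (Function.update rootCHQ (Sum.inl (0, 1)) 52776558133248)
        (Sum.inl (1, 0)) 52776558133248) (Sum.inr 0) 8796093022208) (Sum.inr 1) 26388279066624) (Sum.inr 2) 8796093022208)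
      (Function.update (Function.update (Function.update (Function.update (Function.update rootWHQ (Sum.inl (0, 1)) 17592186044416)
        (Sum.inl (1, 0)) 17592186044416) (Sum.inr 0) 8796093022208) (Sum.inr 1) 8796093022208) (Sum.inr 2) 8796093022208) = true := by
  decide +kernel

set_option maxRecDepth 100000 in
/-- Quarter-root grid box with shuffle part the depth-3 corner cell `ξ ∈ [3/16, 1/4] × [−1/4, −3/16] × [3/16, 1/4]` (inside the sector `Σ`, so the
sector prune does not fire, but `‖ξ‖ ≥ 3√3/16 > 1/4`): ONE ball-prune leaf. [kernel] -/
theorem bulkLeafQ_smoke_ball :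
    bulkLeafQ muRec
      (Function.update (Function.update (Function.update rootCHQ (Sum.inr 0) 61572651155456) (Sum.inr 1) (-61572651155456)) (Sum.inr 2) 61572651155456)
      (Function.update (Function.update (Function.update rootWHQ (Sum.inr 0) 8796093022208) (Sum.inr 1) 8796093022208) (Sum.inr 2) 8796093022208) = true := by
  decide +kernel

/-! ## §4. (appended, hand-1 g42, same generation) THE SEARCH-GRADE BULK VERDICT `bulkLeafCQ`: the quick verdict's twelve sign-free disjuncts, NO guard

`quickQ` / `bulkLeafQ` (§1) REFUSE every box on which the old sign prune `shufOut` fires — right for RE-VALIDATING evaluated trees (R6: a leaf the old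
currency accepted by sign must not pass), wrong as the verdict of a NEW search on the mirror regions `ξ₀ < 0` / `ξ₂ < 0` of the fundamental domain, which
the quotient certifies for real: hand-1 g42's R5 calibration (`searchTreeF`, native) found `bulkLeafQ muRec` failing in 3 ms on `ξ₀ ∈ [−1/32, −1/64]`
(every sub-box refused by the guard), while the boxes touching the walls search identically to the signed verdict.  The search-grade verdict therefore
DROPS the sign disjunct instead of guarding it: `quickCoreQ μ` = disjuncts 2–13 of `…EntryQuickHcp.entryLeafOKHQ μ` verbatim (vector-form tables K1–K4,
sharp fit, fit, class tables K1–K4, radial prune, column prune — each sound on every admissible `(U, ξ)` of the box, no sign, no sector), and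
`bulkLeafCQ μ := quotLeaf (quickCoreQ μ)`.  The R5 plan driver (`PlanDriverHQ.lean`) searches with `bulkLeafCQ`; `bulkLeafQ ⇒ bulkLeafCQ` pointwise. -/

section CoreVerdict

open Summit.AtomisticToContinuum.Crystallization.Theorems.FrustratedLawDichotomyStrainedPatchHomEntrySymBox (symH hbox_symU)
open Summit.AtomisticToContinuum.Crystallization.Theorems.FrustratedLawDichotomyStrainedPatchHomLeafTableCheck (qTableK1 qTableK2 qTableK3 qTableK4 tabE
  qTableK1_allOKK qTableK2_allOKK qTableK3_allOKK qTableK4_allOKK)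
open Summit.AtomisticToContinuum.Crystallization.Theorems.FrustratedLawDichotomyStrainedPatchHomLeafTableCheckHcp (tabSem_of_allOKK)
open Summit.AtomisticToContinuum.Crystallization.Theorems.FrustratedLawDichotomyStrainedPatchHomLeafTableCheckHcpV (entryLeafOKHVT tableLeafOKHV_sound)
open Summit.AtomisticToContinuum.Crystallization.Theorems.FrustratedLawDichotomyStrainedPatchHomEntryTableHcp (entryLeafOKHTW tableLeafOKHW_sound)
open Summit.AtomisticToContinuum.Crystallization.Theorems.FrustratedLawDichotomyStrainedPatchHomEntryGram (colOutOK false_of_colOutOK)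
open Summit.AtomisticToContinuum.Crystallization.Theorems.FrustratedLawDichotomyStrainedPatchHomEntryRadialHcp (radOKH radOKH_sound)
open Summit.AtomisticToContinuum.Crystallization.Theorems.FrustratedLawDichotomyStrainedPatchHomEntryFitHcpKit (fitOKH)
open Summit.AtomisticToContinuum.Crystallization.Theorems.FrustratedLawDichotomyStrainedPatchHomEntryFitHcp (fitOKH_sound)
open Summit.AtomisticToContinuum.Crystallization.Theorems.FrustratedLawDichotomyStrainedPatchHomEntryFitHcpSharpKit (fitOKHS)
open Summit.AtomisticToContinuum.Crystallization.Theorems.FrustratedLawDichotomyStrainedPatchHomEntryFitHcpSharp (fitOKHS_sound)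

/-- ★ **THE SIGN-FREE QUICK VERDICT, SEARCH GRADE**: disjuncts 2–13 of the quick verdict of record `entryLeafOKHQ μ` (its `shufOut` disjunct dropped,
nothing guarded), cheap first. Computable. -/
def quickCoreQ (μ : ℤ) (c w : (Fin 3 × Fin 3) ⊕ Fin 3 → ℤ) : Bool :=
  entryLeafOKHVT qTableK1 tabE μ c w || entryLeafOKHVT qTableK2 tabE μ c w || entryLeafOKHVT qTableK3 tabE μ c w ||
    entryLeafOKHVT qTableK4 tabE μ c w || fitOKHS (symH c) (symH w) || fitOKH (symH c) (symH w) ||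
    entryLeafOKHTW qTableK1 tabE μ c w || entryLeafOKHTW qTableK2 tabE μ c w || entryLeafOKHTW qTableK3 tabE μ c w || entryLeafOKHTW qTableK4 tabE μ c w ||
    radOKH (symH c) (symH w) || colOutOK (fun ab => symH c (Sum.inl ab)) (fun ab => symH w (Sum.inl ab))

/-- ★ Soundness of `quickCoreQ` in the `hver` shape for EVERY admissible `(U, ξ)` of the box (no sign, no sector hypothesis). [folklore chaining: the twelve
sign-free branches of `…QuotLeaf.entryLeafOKHQ_sound_noShuf` verbatim] -/
theorem quickCoreQ_sound {μ : ℤ} {c w : (Fin 3 × Fin 3) ⊕ Fin 3 → ℤ} (h : quickCoreQ μ c w = true)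
    (U : E3 →L[ℝ] E3) (ξ : E3) (hsa : ∀ v v' : E3, ⟪U v, v'⟫ = ⟪v, U v'⟫) (hU : ‖U - 1‖ ≤ 1 / 4)
    (hbox : ∀ ab : Fin 3 × Fin 3, |(U (EuclideanSpace.single ab.2 (1 : ℝ))) ab.1 - (c (Sum.inl ab) : ℝ) / SC| ≤ (w (Sum.inl ab) : ℝ) / SC)
    (hξ : ∀ i : Fin 3, |ξ i - (c (Sum.inr i) : ℝ) / SC| ≤ (w (Sum.inr i) : ℝ) / SC) :
    (∀ (M : ℕ) (z : Fin M → E3) (cc : Fin M), Function.Injective z →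
        Set.range z = {x : E3 | dist x (z cc) ≤ 133 / 10 ∧ ∃ a : Fin 3 → ℤ,
          x = z cc + latPt U hexFrame a ∨ x = z cc + latPt U hexFrame a + U (hcpShift + ξ)} →
        TightNearCap (9 / 5) (3 / 2) z cc ∨ ExemptNear (9 / 5) ExRec z cc ∨ BadNearCap (9 / 5) (3 / 2) z cc) ∨
      (μ : ℝ) / SC ≤ ∑ b ∈ (Fintype.piFinset fun _ : Fin 3 => Finset.Icc (-7 : ℤ) 7).filter (fun b => b ≠ 0), effPot w₄₅ ω₄ (3 / 400) ‖latPt U hexFrame b‖ +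
        ∑ b ∈ (Fintype.piFinset fun _ : Fin 3 => Finset.Icc (-7 : ℤ) 7), effPot w₄₅ ω₄ (3 / 400) ‖latPt U hexFrame b + U (hcpShift + ξ)‖ := by
  simp only [quickCoreQ, entryLeafOKHVT, entryLeafOKHTW, Bool.or_eq_true] at h
  rcases h with ((((((((((h | h) | h) | h) | h) | h) | h) | h) | h) | h) | h) | h
  · exact tableLeafOKHV_sound (tabSem_of_allOKK qTableK1_allOKK) h U ξ hsa hU (hbox_symU hsa hbox) hξ
  · exact tableLeafOKHV_sound (tabSem_of_allOKK qTableK2_allOKK) h U ξ hsa hU (hbox_symU hsa hbox) hξ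
  · exact tableLeafOKHV_sound (tabSem_of_allOKK qTableK3_allOKK) h U ξ hsa hU (hbox_symU hsa hbox) hξ
  · exact tableLeafOKHV_sound (tabSem_of_allOKK qTableK4_allOKK) h U ξ hsa hU (hbox_symU hsa hbox) hξ
  · exact Or.inl (fitOKHS_sound h U ξ hU (hbox_symU hsa hbox) hξ)
  · exact Or.inl (fitOKH_sound h U ξ hU (hbox_symU hsa hbox) hξ)
  · exact tableLeafOKHW_sound (tabSem_of_allOKK qTableK1_allOKK) h U ξ hsa hU (hbox_symU hsa hbox) hξ
  · exact tableLeafOKHW_sound (tabSem_of_allOKK qTableK2_allOKK) h U ξ hsa hU (hbox_symU hsa hbox) hξ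
  · exact tableLeafOKHW_sound (tabSem_of_allOKK qTableK3_allOKK) h U ξ hsa hU (hbox_symU hsa hbox) hξ
  · exact tableLeafOKHW_sound (tabSem_of_allOKK qTableK4_allOKK) h U ξ hsa hU (hbox_symU hsa hbox) hξ
  · exact Or.inl (radOKH_sound h U ξ hU (hbox_symU hsa hbox) hξ)
  · exact (false_of_colOutOK h U hU (hbox_symU hsa hbox)).elim

/-- ★ A box accepted by the search-grade quick verdict is a `semOKHQ μ` fact. [formal bookkeeping: `semOKHQ_of_sound`] -/
theorem semOKHQ_of_quickCoreQ {μ : ℤ} {c w : (Fin 3 × Fin 3) ⊕ Fin 3 → ℤ} (h : quickCoreQ μ c w = true) : semOKHQ μ c w = true :=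
  semOKHQ_of_sound (quickCoreQ μ) (fun _ _ hv U ξ hsa _ hU _ hbox hξ _ _ => quickCoreQ_sound hv U ξ hsa hU hbox hξ) h

/-- ★★ **THE SEARCH-GRADE BULK VERDICT OF THE QUOTIENT ROOT** (the R5 driver's leaf verdict): the two vacuous prunes first, then `quickCoreQ`. Computable. -/
def bulkLeafCQ (μ : ℤ) : ((Fin 3 × Fin 3) ⊕ Fin 3 → ℤ) → ((Fin 3 × Fin 3) ⊕ Fin 3 → ℤ) → Bool := quotLeaf (quickCoreQ μ)

/-- Unfolding the search-grade bulk verdict. [formal bookkeeping] -/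
theorem bulkLeafCQ_eq (μ : ℤ) (c w : (Fin 3 × Fin 3) ⊕ Fin 3 → ℤ) : bulkLeafCQ μ c w = (sectorOut c w || ballOut c w || quickCoreQ μ c w) := rfl

/-- ★★ A box accepted by `bulkLeafCQ μ` is a `semOKHQ μ` fact. [formal bookkeeping: `semOKHQ_of_quotLeaf`] -/
theorem semOKHQ_of_bulkLeafCQ {μ : ℤ} {c w : (Fin 3 × Fin 3) ⊕ Fin 3 → ℤ} (h : bulkLeafCQ μ c w = true) : semOKHQ μ c w = true :=
  semOKHQ_of_quotLeaf (fun _ _ h' => semOKHQ_of_quickCoreQ h') h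

/-- ★★ SHARD CURRENCY 1 for `bulkLeafCQ` (literal kernel tree). [formal bookkeeping] -/
theorem semOKHQ_of_treeOK_bulkLeafCQ {μ : ℤ} (t : CertTree ((Fin 3 × Fin 3) ⊕ Fin 3)) {c w : (Fin 3 × Fin 3) ⊕ Fin 3 → ℤ}
    (h : treeOK (bulkLeafCQ μ) t c w = true) : semOKHQ μ c w = true :=
  semOKHQ_of_treeOK (bulkLeafCQ μ) (fun _ _ h' => semOKHQ_of_bulkLeafCQ h') t c w h

/-- SHARD CURRENCY 2 for `bulkLeafCQ` (∃-tree, the glue currency). [formal bookkeeping] -/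
theorem semOKHQ_of_exists_tree_bulkLeafCQ {μ : ℤ} {c w : (Fin 3 × Fin 3) ⊕ Fin 3 → ℤ}
    (h : ∃ t : CertTree ((Fin 3 × Fin 3) ⊕ Fin 3), treeOK (bulkLeafCQ μ) t c w = true) : semOKHQ μ c w = true := by
  obtain ⟨t, ht⟩ := h
  exact semOKHQ_of_treeOK_bulkLeafCQ t ht

/-- SHARD CURRENCY 3 for `bulkLeafCQ` (kernel search). [formal bookkeeping] -/
theorem semOKHQ_of_searchOK_bulkLeafCQ {μ : ℤ} {sel : ℕ → ((Fin 3 × Fin 3) ⊕ Fin 3 → ℤ) → ((Fin 3 × Fin 3) ⊕ Fin 3 → ℤ) → (Fin 3 × Fin 3) ⊕ Fin 3}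
    {fuel d : ℕ} {c w : (Fin 3 × Fin 3) ⊕ Fin 3 → ℤ} (h : searchOK (bulkLeafCQ μ) sel fuel d c w = true) : semOKHQ μ c w = true :=
  semOKHQ_of_exists_tree_bulkLeafCQ (exists_tree_of_searchOK (bulkLeafCQ μ) sel fuel d c w h)

/-- ★ Level transport for `bulkLeafCQ` shards (certified at `μ₀`, served at every `μ ≤ μ₀`). [formal bookkeeping] -/
theorem semOKHQ_of_treeOK_bulkLeafCQ_level {μ μ₀ : ℤ} (hle : μ ≤ μ₀) (t : CertTree ((Fin 3 × Fin 3) ⊕ Fin 3)) {c w : (Fin 3 × Fin 3) ⊕ Fin 3 → ℤ}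
    (h : treeOK (bulkLeafCQ μ₀) t c w = true) : semOKHQ μ c w = true :=
  semOKHQ_mono_level hle (semOKHQ_of_treeOK_bulkLeafCQ t h)

/-- The guarded quick verdict implies the search-grade one, pointwise. [formal bookkeeping] -/
theorem quickCoreQ_of_quickQ {μ : ℤ} {c w : (Fin 3 × Fin 3) ⊕ Fin 3 → ℤ} (h : quickQ μ c w = true) : quickCoreQ μ c w = true := by
  simp only [quickQ, innerGuardQ, Bool.and_eq_true, Bool.not_eq_true'] at h
  obtain ⟨hs, hq⟩ := h
  unfold entryLeafOKHQ at hq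
  rw [hs, Bool.false_or] at hq
  exact hq

/-- `bulkLeafQ ⇒ bulkLeafCQ` pointwise, hence tree-wise (`treeOK_mono`): every re-validation-grade shard is a search-grade shard. [formal bookkeeping] -/
theorem bulkLeafCQ_of_bulkLeafQ {μ : ℤ} {c w : (Fin 3 × Fin 3) ⊕ Fin 3 → ℤ} (h : bulkLeafQ μ c w = true) : bulkLeafCQ μ c w = true := by
  rw [bulkLeafQ_eq] at h
  rw [bulkLeafCQ_eq]
  simp only [Bool.or_eq_true] at h ⊢
  rcases h with (h | h) | h
  · exact Or.inl (Or.inl h)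
  · exact Or.inl (Or.inr h)
  · exact Or.inr (quickCoreQ_of_quickQ h)

/-- Calibration box `Q3a` of the R5 probe (hand-1 g42): `U`-part = the pilot sub-root `sh500` class (diag (.9661, .9661, .9700) ± (2⁻⁸, 2⁻⁸, 2⁻⁷),
`u₀₁ = 0.05 ± 2⁻⁷`, `u₀₂ = 0 ± 2⁻⁷`, `u₁₂ ∈ [−2⁻⁶, 0]`), shuffle `ξ ∈ [0, 1/32] × [−1/32, 0] × [−1/32, −1/64]` — a MIRROR-REGION box (`ξ₂ < 0`:
the old currency sign-pruned it, the guarded verdict refuses it): centre. -/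
def cQ3a : (Fin 3 × Fin 3) ⊕ Fin 3 → ℤ :=
  fun k => if k = (Sum.inl (0, 0)) then 271931215781560 else if k = (Sum.inl (0, 1)) then 14073748835532 else if k = (Sum.inl (1, 0)) then 14073748835532 else if k = (Sum.inl (1, 1)) then 271931215781560 else if k = (Sum.inl (2, 2)) then 273030727409336 else if k = (Sum.inl (1, 2)) then -2199023255552 else if k = (Sum.inr 0) then 4398046511104 else if k = (Sum.inr 1) then -4398046511104 else if k = (Sum.inr 2) then -6597069766656 else 0

/-- Half-widths of the calibration box `Q3a`. -/
def wQ3a : (Fin 3 × Fin 3) ⊕ Fin 3 → ℤ :=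
  fun k => if k = (Sum.inl (0, 0)) then 1099511627776 else if k = (Sum.inl (1, 1)) then 1099511627776 else if k = (Sum.inr 0) then 4398046511104 else if k = (Sum.inr 1) then 4398046511104 else if k = (Sum.inr 2) then 2199023255552 else 2199023255552

/-- The 12-leaf certificate tree found NATIVELY for `Q3a` by `searchTreeF (bulkLeafCQ muRec)` (selector `iso`, 10.1 s; encoding `9a81LL1LL81LL1LLa8LL8LL`). -/
def tQ3a : CertTree ((Fin 3 × Fin 3) ⊕ Fin 3) :=
  (.split (Sum.inr 0) (.split (Sum.inr 1) (.split (Sum.inl (2, 2)) (.split (Sum.inl (0, 1)) .leaf .leaf) (.split (Sum.inl (0, 1)) .leaf .leaf)) (.split (Sum.inl (2, 2)) (.split (Sum.inl (0, 1)) .leaf .leaf) (.split (Sum.inl (0, 1)) .leaf .leaf))) (.split (Sum.inr 1) (.split (Sum.inl (2, 2)) .leaf .leaf) (.split (Sum.inl (2, 2)) .leaf .leaf)))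

set_option maxRecDepth 100000 in
set_option maxHeartbeats 4000000 in
/-- ★ KERNEL smoke = the first QUOTIENT BULK SHARD in a mirror region: the search-grade verdict certifies `Q3a` with the natively found 12-leaf tree, hence
`semOKHQ muRec cQ3a wQ3a`; the guarded verdict `bulkLeafQ` is `false` on the same box (every sub-box is sign-refused). [kernel + formal bookkeeping] -/
theorem bulkLeafCQ_smoke_mirror : treeOK (bulkLeafCQ muRec) tQ3a cQ3a wQ3a = true ∧ bulkLeafQ muRec cQ3a wQ3a = false := by
  constructor <;> decide +kernel

/-- … hence the mirror-region calibration box is a quotient fact at `muRec`. [formal bookkeeping] -/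
theorem semQ_Q3a : semOKHQ muRec cQ3a wQ3a = true := semOKHQ_of_treeOK_bulkLeafCQ tQ3a bulkLeafCQ_smoke_mirror.1

end CoreVerdict

end Summit.AtomisticToContinuum.Crystallization.Theorems.FrustratedLawDichotomyStrainedPatchHomEntryLeafHT
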